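import Literature.NumberTheory.Sieve.CircleMethod
import HarnessLib

/-!
# Circle method: the ternary Goldbach integral identity (proof)

Topic `Literature/NumberTheory/Sieve`, companion ("Proofs") file of `CircleMethod.lean`, kept
separate so that the statement file keeps its imports and its review queue. It discharges the named
fact `Literature.NumberTheory.Sieve.weightedTernaryCount_eq_integral` of `CircleMethod.lean`:

  `∑_{n₁ + n₂ + n₃ = N} Λ(n₁) Λ(n₂) Λ(n₃) = ∫₀¹ S(α)³ e(−Nα) dα`,  `S(α) = ∑_{1 ≤ n ≤ N} Λ(n) e(nα)`,

as the case `k = 3` of the `k`-fold identity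

  `∫₀¹ S(α)^k e(−Nα) dα = ∑_{n₁ + ⋯ + n_k = N} Λ(n₁) ⋯ Λ(n_k)`   (`integral_primeExpSum_pow_mul_fourierChar`).

## Source

R. C. Vaughan, *The Hardy–Littlewood Method*, 2nd ed., Cambridge Tracts in Mathematics 125,
Cambridge University Press (1997) [VaughanHL1997] (locators read against the held text of the tract):

* §1.2, eq. (1.8): the "trivial orthogonality relation" `∫₀¹ e(αh) dα = 1` when `h = 0`, `0` when
  `h ≠ 0`; eq. (1.9): `∫₀¹ f(α)^s e(−αn) dα = R_s(n)`, where `R_s(n)` counts the representations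
  encoded by the coefficients of `f^s` — the general pattern proved here with von Mangoldt weights;
* §3.1, eq. (3.1): `f(α) = ∑_{p ≤ n} (log p) e(αp)`; eq. (3.4):
  `R(n) = ∫_𝔘 f(α)³ e(−nα) dα = ∫_𝔐 … + ∫_𝔪 …` over a unit interval `𝔘`, with, eq. (3.5),
  `R(n) = ∑_{p₁ + p₂ + p₃ = n} (log p₁)(log p₂)(log p₃)` — the ternary instance. (In the source,
  eq. (3.2) is the choice `P = (log n)^B` of the arc parameter; the identity itself is (3.4)–(3.5).)
  Vaughan weights primes by `log p`; the `Λ`-weighted sum `S(α)` of `CircleMethod.lean` is the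
  variant of Iwaniec–Kowalski, *Analytic Number Theory*, §19.1, with the identical (finite,
  elementary) proof.

## Proof

Extend `S` to `0 ≤ n ≤ N` (`Λ 0 = 0`), expand `S(α)^k` over `k`-tuples (`Finset.sum_pow'`,
`Fintype.piFinset`), merge the characters `∏ᵢ e(nᵢα) · e(−Nα) = e((∑ᵢ nᵢ − N)α)`, exchange the
finite sum with the interval integral, apply the already discharged orthogonality fact
`Literature.NumberTheory.Sieve.integral_fourierChar_intCast_holds` (eq. (1.8)) to each term, and collapse the Kronecker delta
`[∑ᵢ nᵢ = N]` onto `Finset.Nat.antidiagonalTuple k N`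
(`filter_piFinset_range_sum_eq_antidiagonalTuple`). No new definitions; axioms `propext`,
`Classical.choice`, `Quot.sound` only.
-/

noncomputable section

open scoped FourierTransform ArithmeticFunction

open Finset MeasureTheory ArithmeticFunction

namespace Literature.NumberTheory.Sieve

/-- The compositions of `N` into `k` ordered parts (zeros allowed), `Finset.Nat.antidiagonalTuple k N`,
are exactly the `k`-tuples with entries in `{0, …, N}` summing to `N` (each part of a composition is
at most the total). [folklore] -/
theorem filter_piFinset_range_sum_eq_antidiagonalTuple (k N : ℕ) :
    {x ∈ Fintype.piFinset fun _ : Fin k ↦ range (N + 1) | ∑ i, x i = N} =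
      Finset.Nat.antidiagonalTuple k N := by
  ext x
  simp only [mem_filter, Fintype.mem_piFinset, mem_range, Finset.Nat.mem_antidiagonalTuple,
    and_iff_right_iff_imp]
  intro hx i
  rw [← hx, Nat.lt_succ_iff]
  exact Finset.single_le_sum (fun j _ ↦ Nat.zero_le _) (mem_univ i)

/-- The `k`-fold integral identity of the circle method for the von Mangoldt-weighted sum
`S(α) = ∑_{1 ≤ n ≤ N} Λ(n) e(nα)`:
`∫₀¹ S(α)^k e(−Nα) dα = ∑_{n₁ + ⋯ + n_k = N} Λ(n₁) ⋯ Λ(n_k)`,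
the sum running over `Finset.Nat.antidiagonalTuple k N` (tuples with a zero entry contribute
nothing since `Λ 0 = 0`). This is Vaughan, *The Hardy–Littlewood Method*, 2nd ed., §1.2, eq. (1.9),
`∫₀¹ f(α)^s e(−αn) dα = R_s(n)`, for the weighted sum `S` in place of `f`, deduced exactly as there
from the orthogonality relation (1.8) (`integral_fourierChar_intCast_holds`): extend `S` to
`0 ≤ n ≤ N`, expand `S^k` over `k`-tuples (`Finset.sum_pow'`), merge the characters, exchange the
finite sum with the integral, and collapse the Kronecker delta `[∑ᵢ nᵢ = N]`.
[cite: VaughanHL1997, §1.2 eqs. (1.8)–(1.9)] -/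
theorem integral_primeExpSum_pow_mul_fourierChar (k N : ℕ) :
    ∫ α in (0 : ℝ)..1, primeExpSum N α ^ k * (𝐞 (-(N * α)) : ℂ) =
      ∑ x ∈ Finset.Nat.antidiagonalTuple k N, ∏ i, (Λ (x i) : ℂ) := by
  -- extend the range of summation to `0 ≤ n ≤ N` (harmless since `Λ 0 = 0`)
  have hS : ∀ α : ℝ, primeExpSum N α = ∑ n ∈ range (N + 1), (Λ n : ℂ) * (𝐞 (n * α) : ℂ) := by
    intro α
    rw [primeExpSum, Nat.range_succ_eq_Icc_zero, Icc_eq_cons_Ioc (Nat.zero_le N), sum_cons,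
      ← Finset.Icc_add_one_left_eq_Ioc, zero_add]
    simp
  -- multiplicativity of the character: `∏ᵢ e(xᵢ α) · e(−N α) = e((∑ᵢ xᵢ − N) α)`
  have hchar : ∀ (x : Fin k → ℕ) (α : ℝ),
      (∏ i, (𝐞 ((x i : ℝ) * α) : ℂ)) * (𝐞 (-(N * α)) : ℂ) =
        (𝐞 ((((∑ i, x i : ℕ) : ℤ) - N : ℤ) * α) : ℂ) := by
    intro x α
    simp only [Real.fourierChar_apply, ← Complex.exp_sum, ← Complex.exp_add]
    congr 1
    push_cast
    simp only [← Finset.sum_mul, ← Finset.mul_sum]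
    ring
  -- expand the integrand into a sum of characters over `k`-tuples
  have hI : ∀ α : ℝ, primeExpSum N α ^ k * (𝐞 (-(N * α)) : ℂ) =
      ∑ x ∈ Fintype.piFinset (fun _ : Fin k ↦ range (N + 1)),
        (∏ i, (Λ (x i) : ℂ)) * (𝐞 ((((∑ i, x i : ℕ) : ℤ) - N : ℤ) * α) : ℂ) := by
    intro α
    rw [hS, Finset.sum_pow', Finset.sum_mul]
    refine sum_congr rfl fun x _ ↦ ?_
    rw [prod_mul_distrib, mul_assoc, hchar]
  simp_rw [hI]
  -- exchange sum and integral, then apply orthogonality (1.8) termwise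
  rw [intervalIntegral.integral_finsetSum fun x _ ↦ Continuous.intervalIntegrable (by fun_prop) _ _]
  have horth : ∀ m : ℤ, ∫ α in (0 : ℝ)..1, (𝐞 (m * α) : ℂ) = if m = 0 then 1 else 0 :=
    integral_fourierChar_intCast_holds
  simp_rw [intervalIntegral.integral_const_mul, horth]
  -- collapse the Kronecker delta onto the compositions of `N`
  rw [← filter_piFinset_range_sum_eq_antidiagonalTuple, Finset.sum_filter]
  refine sum_congr rfl fun x _ ↦ ?_
  have hiff : ((((∑ i, x i : ℕ) : ℤ) - N : ℤ) = 0) ↔ ∑ i, x i = N := by omega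
  simp_rw [mul_ite, mul_one, mul_zero, hiff]

/-- **Discharge** of `weightedTernaryCount_eq_integral`:
`∑_{n₁ + n₂ + n₃ = N} Λ(n₁) Λ(n₂) Λ(n₃) = ∫₀¹ S(α)³ e(−Nα) dα`. This is Vaughan,
*The Hardy–Littlewood Method*, 2nd ed., §3.1, eq. (3.4): `R(n) = ∫_𝔘 f(α)³ e(−nα) dα` (`𝔘` a unit
interval, then split into major and minor arcs), with `R(n) = ∑_{p₁ + p₂ + p₃ = n} (log p₁)(log p₂)(log p₃)`
(eq. (3.5)) and `f(α) = ∑_{p ≤ n} (log p) e(αp)` (eq. (3.1)) — the case `s = 3` of §1.2, eq. (1.9).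
Vaughan weights primes by `log p`; the `Λ`-weighted form stated in `CircleMethod.lean` (whose docstring
locator "eq. (3.2)" points at the neighbouring display `P = (log n)^B`; the identity is (3.4)–(3.5)) is
the Iwaniec–Kowalski §19.1 variant and has the identical proof, carried out for every `k` in
`integral_primeExpSum_pow_mul_fourierChar`; here `k = 3`, and the cast `ℝ → ℂ` commutes with the
finite sum and product. [cite: VaughanHL1997, §3.1 eqs. (3.4)–(3.5); §1.2 eq. (1.9)] -/
theorem weightedTernaryCount_eq_integral_holds : weightedTernaryCount_eq_integral := by
  intro N
  rw [weightedTernaryCount]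
  exact_mod_cast (integral_primeExpSum_pow_mul_fourierChar 3 N).symm

end Literature.NumberTheory.Sieve
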